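import Mathlib.Algebra.MvPolynomial.Basic
import Mathlib.RingTheory.Adjoin.Polynomial.Basic
import Mathlib.Algebra.MvPolynomial.CommRing
import Mathlib.Data.Real.Basic
import Mathlib.Algebra.BigOperators.Fin
import Mathlib.Tactic.Ring
import Mathlib.Tactic.FinCases
import Mathlib.Tactic.NormNum
import HarnessLib

/-!
# The `S₃`-harmonic module structure of `ℝ[θ₀,θ₁,θ₂]` over the power sums: the six harmonics (derivatives of the Vandermonde), the 18 structure constants, and GENERATION of `ℝ[θ]` by the harmonics over `ℝ[p₁,p₂,p₃]`
# (Chevalley's theorem for `S₃` made explicit; Humphreys, *Reflection Groups and Coxeter Groups* §3.6; Warner II §8.4.3 — ROAD A-IV brick (e), `MvPolynomial` shape «P» asked by the (d2) consumer)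

Topic `Algebra/Polynomial`; namespace `Literature.Algebra.Polynomial`.  Definition lane (four explicit `def`s + theorems; no instance, no notation, no axiom, no `sorry`).  Cell `pub/hodgecm-mathlib`,
ENGINE T1 (crux H413 = `stmt-HodgeConjecture-24833`); ROAD «A6-IV» (`F0/P3a/F0P3a-p05/g15/DESIGN-A6-InHouse-v2-ArchitectureIV` 93542b84 §1 (S2)–(S3), SPEC fb65bd65 brick (e)); owner F0P3a-p05 (g15);
shape «P» = `MvPolynomial (Fin 3) ℝ` chosen by the (d1′)∕(d2) consumer F0P3a-p02 (g14) 19:28:30Z; table computed by exact rational linear algebra (`F0/P3a/F0P3a-p09/g2/e/s3module.generator…py`,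
unique solutions) and independently re-verified by ref4 (g0) 19:28:16Z; author F0P3a-p09 (g2), 2026-09-01.

THE MATHEMATICS.  `W = S₃` permutes the coordinates of `𝔧 ≅ ℝ³`; `ℝ[θ₀,θ₁,θ₂]` is a FREE module of rank 6 over the invariants `ℝ[p₁,p₂,p₃]` (`p_k = Σ_i θ_i^k`) with basis the HARMONICS = the
derivatives of the Vandermonde `π = (θ₀−θ₁)(θ₀−θ₂)(θ₁−θ₂)` [Chevalley; Humphreys §3.6]: `u₀ = 1`, `u₁ = θ₀−θ₁` (compact root), `u₂ = θ₁−θ₂`, `u₃ = ∂₀π`, `u₄ = ∂₁π`, `u₅ = π`.  THIS FILE: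
* `s3PowerSum`, `s3PowerSumVec = ![p₁,p₂,p₃]`, `s3HarmonicPoly : Fin 6 → MvPolynomial (Fin 3) ℝ`, and the STRUCTURE CONSTANTS `s3CoeffPoly k i j : MvPolynomial (Fin 3) ℝ` — polynomials in
  three ABSTRACT variables to be EVALUATED at `(p₁,p₂,p₃)` (`MvPolynomial.aeval s3PowerSumVec`), with INTEGER coefficients after clearing the common denominator 18;
* **`coord_mul_s3HarmonicPoly`** : `18 · (X k · u_i) = Σ_j aeval p (s3CoeffPoly k i j) · u_j` (the 18 products; each a `ring` identity in `MvPolynomial (Fin 3) ℝ`);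
* `aeval_s3CoeffPoly_mem_adjoin` : the coefficients lie in the invariant subalgebra `Algebra.adjoin ℝ (range ![p₁,p₂,p₃])` (for free: they are `aeval`-images);
* **`exists_adjoin_powerSum_combination`** : EVERY `q ∈ ℝ[θ₀,θ₁,θ₂]` is `Σ_j c_j · u_j` with all `c_j ∈ Algebra.adjoin ℝ (range ![p₁,p₂,p₃])` (generation half of Chevalley's theorem for `S₃`, by
  `MvPolynomial.induction_on` from the 18 products) — the uniform-in-order input of the bootstrap (Warner 8.4.3: `∂(q)φ_f = Σ_j ∂(u_j)(∂(c_j(p̄))φ_f) = Σ_j ∂(u_j) φ_{Z_j f}`).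
NOT here: uniqueness of the `c_j` (freeness), harmonicity `Δu_j = 0`, the operator calculus `q ↦ ∂(q)` (generic file `PolynomialDerivOperator`, separate).
HONEST LABEL: HC_CM is proved only modulo the printed citations until rung 0 closes; bookkeeping algebra, pays no row by itself.

## References
* [Humphreys1990] J. E. Humphreys, *Reflection Groups and Coxeter Groups* (1990), §3.6 (Chevalley's theorem; harmonic polynomials).
* [WarnerHASSLG2] G. Warner, *Harmonic Analysis on Semi-Simple Lie Groups II* (1972), §8.4.3 (the holonomic system on a chamber).
-/

set_option autoImplicit false

noncomputable section

open MvPolynomial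

namespace Literature.Algebra.Polynomial

/-- The power sum `p_k = X₀^k + X₁^k + X₂^k ∈ ℝ[θ₀,θ₁,θ₂]` (the `S₃`-invariant generators for `k = 1,2,3`; on `torusH θ` the (a0) invariants `invP₁, invP₂, invP₃` evaluate to `p₁, −p₂, −p₃`).
[cite: Humphreys1990, §3.6] -/
def s3PowerSum (k : ℕ) : MvPolynomial (Fin 3) ℝ := X 0 ^ k + X 1 ^ k + X 2 ^ k

/-- The vector `(p₁, p₂, p₃)` of power sums, the evaluation point of the structure constants. [cite: Humphreys1990, §3.6] -/
def s3PowerSumVec : Fin 3 → MvPolynomial (Fin 3) ℝ := ![s3PowerSum 1, s3PowerSum 2, s3PowerSum 3]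

/-- The six `S₃`-HARMONIC polynomials — the derivatives of the Vandermonde `π = (X₀−X₁)(X₀−X₂)(X₁−X₂)`: `u₀ = 1`, `u₁ = X₀−X₁`, `u₂ = X₁−X₂`, `u₃ = ∂₀π`, `u₄ = ∂₁π`, `u₅ = π`.
[cite: Humphreys1990, §3.6] -/
def s3HarmonicPoly : Fin 6 → MvPolynomial (Fin 3) ℝ :=
  ![1, X 0 - X 1, X 1 - X 2, 2 * X 0 * X 1 - 2 * X 0 * X 2 - X 1 ^ 2 + X 2 ^ 2, X 0 ^ 2 - 2 * X 0 * X 1 + 2 * X 1 * X 2 - X 2 ^ 2, (X 0 - X 1) * (X 0 - X 2) * (X 1 - X 2)]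

/-- The STRUCTURE CONSTANTS (× 18) of multiplication by a coordinate on the harmonic basis, as polynomials in three abstract variables standing for `(p₁,p₂,p₃)`, with integer coefficients:
the table `k ↦ i ↦ (j ↦ Q^k_{ij})` with `18 · (X_k · u_i) = Σ_j Q^k_{ij}(p₁,p₂,p₃) · u_j`. [cite: Humphreys1990, §3.6] -/
def s3CoeffPolyTable : Fin 3 → Fin 6 → Fin 6 → MvPolynomial (Fin 3) ℝ :=
  ![![![(6 : MvPolynomial (Fin 3) ℝ) * X 0, (12 : MvPolynomial (Fin 3) ℝ), (6 : MvPolynomial (Fin 3) ℝ), 0, 0, 0],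
      ![(9 : MvPolynomial (Fin 3) ℝ) * X 1 + (-3 : MvPolynomial (Fin 3) ℝ) * X 0 ^ 2, (6 : MvPolynomial (Fin 3) ℝ) * X 0, 0, 0, (6 : MvPolynomial (Fin 3) ℝ), 0],
      ![0, 0, (6 : MvPolynomial (Fin 3) ℝ) * X 0, (6 : MvPolynomial (Fin 3) ℝ), 0, 0],
      ![0, 0, (9 : MvPolynomial (Fin 3) ℝ) * X 1 + (-3 : MvPolynomial (Fin 3) ℝ) * X 0 ^ 2, (6 : MvPolynomial (Fin 3) ℝ) * X 0, 0, (18 : MvPolynomial (Fin 3) ℝ)],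
      ![(27 : MvPolynomial (Fin 3) ℝ) * X 2 + (-27 : MvPolynomial (Fin 3) ℝ) * X 0 * X 1 + (6 : MvPolynomial (Fin 3) ℝ) * X 0 ^ 3, (9 : MvPolynomial (Fin 3) ℝ) * X 1 + (-3 : MvPolynomial (Fin 3) ℝ) * X 0 ^ 2, 0, 0, (6 : MvPolynomial (Fin 3) ℝ) * X 0, (-9 : MvPolynomial (Fin 3) ℝ)],
      ![0, 0, (18 : MvPolynomial (Fin 3) ℝ) * X 2 + (-18 : MvPolynomial (Fin 3) ℝ) * X 0 * X 1 + (4 : MvPolynomial (Fin 3) ℝ) * X 0 ^ 3, (6 : MvPolynomial (Fin 3) ℝ) * X 1 + (-2 : MvPolynomial (Fin 3) ℝ) * X 0 ^ 2, 0, (6 : MvPolynomial (Fin 3) ℝ) * X 0]],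
    ![![(6 : MvPolynomial (Fin 3) ℝ) * X 0, (-6 : MvPolynomial (Fin 3) ℝ), (6 : MvPolynomial (Fin 3) ℝ), 0, 0, 0],
      ![(-9 : MvPolynomial (Fin 3) ℝ) * X 1 + (3 : MvPolynomial (Fin 3) ℝ) * X 0 ^ 2, (6 : MvPolynomial (Fin 3) ℝ) * X 0, 0, (6 : MvPolynomial (Fin 3) ℝ), 0, 0],
      ![(9 : MvPolynomial (Fin 3) ℝ) * X 1 + (-3 : MvPolynomial (Fin 3) ℝ) * X 0 ^ 2, 0, (6 : MvPolynomial (Fin 3) ℝ) * X 0, (-6 : MvPolynomial (Fin 3) ℝ), (-6 : MvPolynomial (Fin 3) ℝ), 0],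
      ![(-27 : MvPolynomial (Fin 3) ℝ) * X 2 + (27 : MvPolynomial (Fin 3) ℝ) * X 0 * X 1 + (-6 : MvPolynomial (Fin 3) ℝ) * X 0 ^ 3, (9 : MvPolynomial (Fin 3) ℝ) * X 1 + (-3 : MvPolynomial (Fin 3) ℝ) * X 0 ^ 2, 0, (6 : MvPolynomial (Fin 3) ℝ) * X 0, 0, (-9 : MvPolynomial (Fin 3) ℝ)],
      ![0, (-9 : MvPolynomial (Fin 3) ℝ) * X 1 + (3 : MvPolynomial (Fin 3) ℝ) * X 0 ^ 2, (-9 : MvPolynomial (Fin 3) ℝ) * X 1 + (3 : MvPolynomial (Fin 3) ℝ) * X 0 ^ 2, 0, (6 : MvPolynomial (Fin 3) ℝ) * X 0, (18 : MvPolynomial (Fin 3) ℝ)],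
      ![0, (-18 : MvPolynomial (Fin 3) ℝ) * X 2 + (18 : MvPolynomial (Fin 3) ℝ) * X 0 * X 1 + (-4 : MvPolynomial (Fin 3) ℝ) * X 0 ^ 3, (-18 : MvPolynomial (Fin 3) ℝ) * X 2 + (18 : MvPolynomial (Fin 3) ℝ) * X 0 * X 1 + (-4 : MvPolynomial (Fin 3) ℝ) * X 0 ^ 3, 0, (6 : MvPolynomial (Fin 3) ℝ) * X 1 + (-2 : MvPolynomial (Fin 3) ℝ) * X 0 ^ 2, (6 : MvPolynomial (Fin 3) ℝ) * X 0]],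
    ![![(6 : MvPolynomial (Fin 3) ℝ) * X 0, (-6 : MvPolynomial (Fin 3) ℝ), (-12 : MvPolynomial (Fin 3) ℝ), 0, 0, 0],
      ![0, (6 : MvPolynomial (Fin 3) ℝ) * X 0, 0, (-6 : MvPolynomial (Fin 3) ℝ), (-6 : MvPolynomial (Fin 3) ℝ), 0],
      ![(-9 : MvPolynomial (Fin 3) ℝ) * X 1 + (3 : MvPolynomial (Fin 3) ℝ) * X 0 ^ 2, 0, (6 : MvPolynomial (Fin 3) ℝ) * X 0, 0, (6 : MvPolynomial (Fin 3) ℝ), 0],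
      ![(27 : MvPolynomial (Fin 3) ℝ) * X 2 + (-27 : MvPolynomial (Fin 3) ℝ) * X 0 * X 1 + (6 : MvPolynomial (Fin 3) ℝ) * X 0 ^ 3, (-9 : MvPolynomial (Fin 3) ℝ) * X 1 + (3 : MvPolynomial (Fin 3) ℝ) * X 0 ^ 2, (-9 : MvPolynomial (Fin 3) ℝ) * X 1 + (3 : MvPolynomial (Fin 3) ℝ) * X 0 ^ 2, (6 : MvPolynomial (Fin 3) ℝ) * X 0, 0, (-9 : MvPolynomial (Fin 3) ℝ)],
      ![(-27 : MvPolynomial (Fin 3) ℝ) * X 2 + (27 : MvPolynomial (Fin 3) ℝ) * X 0 * X 1 + (-6 : MvPolynomial (Fin 3) ℝ) * X 0 ^ 3, 0, (9 : MvPolynomial (Fin 3) ℝ) * X 1 + (-3 : MvPolynomial (Fin 3) ℝ) * X 0 ^ 2, 0, (6 : MvPolynomial (Fin 3) ℝ) * X 0, (-9 : MvPolynomial (Fin 3) ℝ)],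
      ![0, (18 : MvPolynomial (Fin 3) ℝ) * X 2 + (-18 : MvPolynomial (Fin 3) ℝ) * X 0 * X 1 + (4 : MvPolynomial (Fin 3) ℝ) * X 0 ^ 3, 0, (-6 : MvPolynomial (Fin 3) ℝ) * X 1 + (2 : MvPolynomial (Fin 3) ℝ) * X 0 ^ 2, (-6 : MvPolynomial (Fin 3) ℝ) * X 1 + (2 : MvPolynomial (Fin 3) ℝ) * X 0 ^ 2, (6 : MvPolynomial (Fin 3) ℝ) * X 0]]]

/-- The structure constant `Q^k_{ij}` (× 18): `18 · (X_k · u_i) = Σ_j (s3CoeffPoly k i j)(p₁,p₂,p₃) · u_j`. [cite: Humphreys1990, §3.6] -/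
def s3CoeffPoly (k : Fin 3) (i j : Fin 6) : MvPolynomial (Fin 3) ℝ := s3CoeffPolyTable k i j

/-- The product `18·X 0·u0` on the harmonic basis. [cite: Humphreys1990, §3.6] -/
private theorem coord_mul_s3HarmonicPoly_0_0 :
    (18 : MvPolynomial (Fin 3) ℝ) * (X 0 * s3HarmonicPoly 0) = ∑ j : Fin 6, aeval s3PowerSumVec (s3CoeffPoly 0 0 j) * s3HarmonicPoly j := by
  simp [Fin.sum_univ_six, s3CoeffPoly, s3CoeffPolyTable, s3HarmonicPoly, s3PowerSumVec, s3PowerSum]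
  ring

/-- The product `18·X 0·u1` on the harmonic basis. [cite: Humphreys1990, §3.6] -/
private theorem coord_mul_s3HarmonicPoly_0_1 :
    (18 : MvPolynomial (Fin 3) ℝ) * (X 0 * s3HarmonicPoly 1) = ∑ j : Fin 6, aeval s3PowerSumVec (s3CoeffPoly 0 1 j) * s3HarmonicPoly j := by
  simp [Fin.sum_univ_six, s3CoeffPoly, s3CoeffPolyTable, s3HarmonicPoly, s3PowerSumVec, s3PowerSum]
  ring

/-- The product `18·X 0·u2` on the harmonic basis. [cite: Humphreys1990, §3.6] -/
private theorem coord_mul_s3HarmonicPoly_0_2 :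
    (18 : MvPolynomial (Fin 3) ℝ) * (X 0 * s3HarmonicPoly 2) = ∑ j : Fin 6, aeval s3PowerSumVec (s3CoeffPoly 0 2 j) * s3HarmonicPoly j := by
  simp [Fin.sum_univ_six, s3CoeffPoly, s3CoeffPolyTable, s3HarmonicPoly, s3PowerSumVec, s3PowerSum]
  ring

/-- The product `18·X 0·u3` on the harmonic basis. [cite: Humphreys1990, §3.6] -/
private theorem coord_mul_s3HarmonicPoly_0_3 :
    (18 : MvPolynomial (Fin 3) ℝ) * (X 0 * s3HarmonicPoly 3) = ∑ j : Fin 6, aeval s3PowerSumVec (s3CoeffPoly 0 3 j) * s3HarmonicPoly j := by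
  simp [Fin.sum_univ_six, s3CoeffPoly, s3CoeffPolyTable, s3HarmonicPoly, s3PowerSumVec, s3PowerSum]
  ring

/-- The product `18·X 0·u4` on the harmonic basis. [cite: Humphreys1990, §3.6] -/
private theorem coord_mul_s3HarmonicPoly_0_4 :
    (18 : MvPolynomial (Fin 3) ℝ) * (X 0 * s3HarmonicPoly 4) = ∑ j : Fin 6, aeval s3PowerSumVec (s3CoeffPoly 0 4 j) * s3HarmonicPoly j := by
  simp [Fin.sum_univ_six, s3CoeffPoly, s3CoeffPolyTable, s3HarmonicPoly, s3PowerSumVec, s3PowerSum]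
  ring

/-- The product `18·X 0·u5` on the harmonic basis. [cite: Humphreys1990, §3.6] -/
private theorem coord_mul_s3HarmonicPoly_0_5 :
    (18 : MvPolynomial (Fin 3) ℝ) * (X 0 * s3HarmonicPoly 5) = ∑ j : Fin 6, aeval s3PowerSumVec (s3CoeffPoly 0 5 j) * s3HarmonicPoly j := by
  simp [Fin.sum_univ_six, s3CoeffPoly, s3CoeffPolyTable, s3HarmonicPoly, s3PowerSumVec, s3PowerSum]
  ring

/-- The product `18·X 1·u0` on the harmonic basis. [cite: Humphreys1990, §3.6] -/
private theorem coord_mul_s3HarmonicPoly_1_0 :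
    (18 : MvPolynomial (Fin 3) ℝ) * (X 1 * s3HarmonicPoly 0) = ∑ j : Fin 6, aeval s3PowerSumVec (s3CoeffPoly 1 0 j) * s3HarmonicPoly j := by
  simp [Fin.sum_univ_six, s3CoeffPoly, s3CoeffPolyTable, s3HarmonicPoly, s3PowerSumVec, s3PowerSum]
  ring

/-- The product `18·X 1·u1` on the harmonic basis. [cite: Humphreys1990, §3.6] -/
private theorem coord_mul_s3HarmonicPoly_1_1 :
    (18 : MvPolynomial (Fin 3) ℝ) * (X 1 * s3HarmonicPoly 1) = ∑ j : Fin 6, aeval s3PowerSumVec (s3CoeffPoly 1 1 j) * s3HarmonicPoly j := by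
  simp [Fin.sum_univ_six, s3CoeffPoly, s3CoeffPolyTable, s3HarmonicPoly, s3PowerSumVec, s3PowerSum]
  ring

/-- The product `18·X 1·u2` on the harmonic basis. [cite: Humphreys1990, §3.6] -/
private theorem coord_mul_s3HarmonicPoly_1_2 :
    (18 : MvPolynomial (Fin 3) ℝ) * (X 1 * s3HarmonicPoly 2) = ∑ j : Fin 6, aeval s3PowerSumVec (s3CoeffPoly 1 2 j) * s3HarmonicPoly j := by
  simp [Fin.sum_univ_six, s3CoeffPoly, s3CoeffPolyTable, s3HarmonicPoly, s3PowerSumVec, s3PowerSum]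
  ring

/-- The product `18·X 1·u3` on the harmonic basis. [cite: Humphreys1990, §3.6] -/
private theorem coord_mul_s3HarmonicPoly_1_3 :
    (18 : MvPolynomial (Fin 3) ℝ) * (X 1 * s3HarmonicPoly 3) = ∑ j : Fin 6, aeval s3PowerSumVec (s3CoeffPoly 1 3 j) * s3HarmonicPoly j := by
  simp [Fin.sum_univ_six, s3CoeffPoly, s3CoeffPolyTable, s3HarmonicPoly, s3PowerSumVec, s3PowerSum]
  ring

/-- The product `18·X 1·u4` on the harmonic basis. [cite: Humphreys1990, §3.6] -/
private theorem coord_mul_s3HarmonicPoly_1_4 :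
    (18 : MvPolynomial (Fin 3) ℝ) * (X 1 * s3HarmonicPoly 4) = ∑ j : Fin 6, aeval s3PowerSumVec (s3CoeffPoly 1 4 j) * s3HarmonicPoly j := by
  simp [Fin.sum_univ_six, s3CoeffPoly, s3CoeffPolyTable, s3HarmonicPoly, s3PowerSumVec, s3PowerSum]
  ring

/-- The product `18·X 1·u5` on the harmonic basis. [cite: Humphreys1990, §3.6] -/
private theorem coord_mul_s3HarmonicPoly_1_5 :
    (18 : MvPolynomial (Fin 3) ℝ) * (X 1 * s3HarmonicPoly 5) = ∑ j : Fin 6, aeval s3PowerSumVec (s3CoeffPoly 1 5 j) * s3HarmonicPoly j := by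
  simp [Fin.sum_univ_six, s3CoeffPoly, s3CoeffPolyTable, s3HarmonicPoly, s3PowerSumVec, s3PowerSum]
  ring

/-- The product `18·X 2·u0` on the harmonic basis. [cite: Humphreys1990, §3.6] -/
private theorem coord_mul_s3HarmonicPoly_2_0 :
    (18 : MvPolynomial (Fin 3) ℝ) * (X 2 * s3HarmonicPoly 0) = ∑ j : Fin 6, aeval s3PowerSumVec (s3CoeffPoly 2 0 j) * s3HarmonicPoly j := by
  simp [Fin.sum_univ_six, s3CoeffPoly, s3CoeffPolyTable, s3HarmonicPoly, s3PowerSumVec, s3PowerSum]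
  ring

/-- The product `18·X 2·u1` on the harmonic basis. [cite: Humphreys1990, §3.6] -/
private theorem coord_mul_s3HarmonicPoly_2_1 :
    (18 : MvPolynomial (Fin 3) ℝ) * (X 2 * s3HarmonicPoly 1) = ∑ j : Fin 6, aeval s3PowerSumVec (s3CoeffPoly 2 1 j) * s3HarmonicPoly j := by
  simp [Fin.sum_univ_six, s3CoeffPoly, s3CoeffPolyTable, s3HarmonicPoly, s3PowerSumVec, s3PowerSum]
  ring

/-- The product `18·X 2·u2` on the harmonic basis. [cite: Humphreys1990, §3.6] -/
private theorem coord_mul_s3HarmonicPoly_2_2 :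
    (18 : MvPolynomial (Fin 3) ℝ) * (X 2 * s3HarmonicPoly 2) = ∑ j : Fin 6, aeval s3PowerSumVec (s3CoeffPoly 2 2 j) * s3HarmonicPoly j := by
  simp [Fin.sum_univ_six, s3CoeffPoly, s3CoeffPolyTable, s3HarmonicPoly, s3PowerSumVec, s3PowerSum]
  ring

/-- The product `18·X 2·u3` on the harmonic basis. [cite: Humphreys1990, §3.6] -/
private theorem coord_mul_s3HarmonicPoly_2_3 :
    (18 : MvPolynomial (Fin 3) ℝ) * (X 2 * s3HarmonicPoly 3) = ∑ j : Fin 6, aeval s3PowerSumVec (s3CoeffPoly 2 3 j) * s3HarmonicPoly j := by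
  simp [Fin.sum_univ_six, s3CoeffPoly, s3CoeffPolyTable, s3HarmonicPoly, s3PowerSumVec, s3PowerSum]
  ring

/-- The product `18·X 2·u4` on the harmonic basis. [cite: Humphreys1990, §3.6] -/
private theorem coord_mul_s3HarmonicPoly_2_4 :
    (18 : MvPolynomial (Fin 3) ℝ) * (X 2 * s3HarmonicPoly 4) = ∑ j : Fin 6, aeval s3PowerSumVec (s3CoeffPoly 2 4 j) * s3HarmonicPoly j := by
  simp [Fin.sum_univ_six, s3CoeffPoly, s3CoeffPolyTable, s3HarmonicPoly, s3PowerSumVec, s3PowerSum]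
  ring

/-- The product `18·X 2·u5` on the harmonic basis. [cite: Humphreys1990, §3.6] -/
private theorem coord_mul_s3HarmonicPoly_2_5 :
    (18 : MvPolynomial (Fin 3) ℝ) * (X 2 * s3HarmonicPoly 5) = ∑ j : Fin 6, aeval s3PowerSumVec (s3CoeffPoly 2 5 j) * s3HarmonicPoly j := by
  simp [Fin.sum_univ_six, s3CoeffPoly, s3CoeffPolyTable, s3HarmonicPoly, s3PowerSumVec, s3PowerSum]
  ring

/-- **THE MULTIPLICATION TABLE**: `18 · (X_k · u_i) = Σ_{j<6} (s3CoeffPoly k i j)(p₁,p₂,p₃) · u_j` in `ℝ[θ₀,θ₁,θ₂]`, for every coordinate `k` and harmonic `i`. [cite: Humphreys1990, §3.6] [cite: WarnerHASSLG2, §8.4.3] -/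
theorem coord_mul_s3HarmonicPoly (k : Fin 3) (i : Fin 6) :
    (18 : MvPolynomial (Fin 3) ℝ) * (X k * s3HarmonicPoly i) = ∑ j : Fin 6, aeval s3PowerSumVec (s3CoeffPoly k i j) * s3HarmonicPoly j := by
  fin_cases k <;> fin_cases i
  · exact coord_mul_s3HarmonicPoly_0_0
  · exact coord_mul_s3HarmonicPoly_0_1
  · exact coord_mul_s3HarmonicPoly_0_2
  · exact coord_mul_s3HarmonicPoly_0_3
  · exact coord_mul_s3HarmonicPoly_0_4
  · exact coord_mul_s3HarmonicPoly_0_5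
  · exact coord_mul_s3HarmonicPoly_1_0
  · exact coord_mul_s3HarmonicPoly_1_1
  · exact coord_mul_s3HarmonicPoly_1_2
  · exact coord_mul_s3HarmonicPoly_1_3
  · exact coord_mul_s3HarmonicPoly_1_4
  · exact coord_mul_s3HarmonicPoly_1_5
  · exact coord_mul_s3HarmonicPoly_2_0
  · exact coord_mul_s3HarmonicPoly_2_1
  · exact coord_mul_s3HarmonicPoly_2_2
  · exact coord_mul_s3HarmonicPoly_2_3
  · exact coord_mul_s3HarmonicPoly_2_4
  · exact coord_mul_s3HarmonicPoly_2_5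

/-- The evaluated structure constants lie in the invariant subalgebra `ℝ[p₁,p₂,p₃] = Algebra.adjoin ℝ (range ![p₁,p₂,p₃])`. [cite: Humphreys1990, §3.6] -/
theorem aeval_s3CoeffPoly_mem_adjoin (k : Fin 3) (i j : Fin 6) :
    aeval s3PowerSumVec (s3CoeffPoly k i j) ∈ Algebra.adjoin ℝ (Set.range s3PowerSumVec) := by
  rw [Algebra.adjoin_range_eq_range_aeval]
  exact ⟨_, rfl⟩

/-- The divided form of the table: `X_k · u_i = Σ_j ((1∕18) • (s3CoeffPoly k i j)(p)) · u_j`. [cite: Humphreys1990, §3.6] -/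
theorem X_mul_s3HarmonicPoly (k : Fin 3) (i : Fin 6) :
    X k * s3HarmonicPoly i = ∑ j : Fin 6, ((1 / 18 : ℝ) • aeval s3PowerSumVec (s3CoeffPoly k i j)) * s3HarmonicPoly j := by
  have h := coord_mul_s3HarmonicPoly k i
  have h18 : (18 : MvPolynomial (Fin 3) ℝ) = C (18 : ℝ) := by rw [map_ofNat]
  calc X k * s3HarmonicPoly i = C (1 / 18 : ℝ) * ((18 : MvPolynomial (Fin 3) ℝ) * (X k * s3HarmonicPoly i)) := by
        rw [h18, ← mul_assoc, ← C_mul]; norm_num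
    _ = ∑ j : Fin 6, ((1 / 18 : ℝ) • aeval s3PowerSumVec (s3CoeffPoly k i j)) * s3HarmonicPoly j := by
        rw [h, Finset.mul_sum]
        refine Finset.sum_congr rfl fun j _ => ?_
        rw [smul_eq_C_mul, mul_assoc]

/-- **GENERATION (Chevalley for `S₃`, the spanning half)**: every polynomial in three variables is a combination of the six harmonics with coefficients in the invariant subalgebra
`ℝ[p₁,p₂,p₃]`: `∃ c : Fin 6 → ℝ[θ], (∀ j, c j ∈ Algebra.adjoin ℝ (range ![p₁,p₂,p₃])) ∧ q = Σ_j c j · u_j` (induction on `q`: constants, sums, and multiplication by `X_k` through the table).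
[cite: Humphreys1990, §3.6] [cite: WarnerHASSLG2, §8.4.3] -/
theorem exists_adjoin_powerSum_combination (q : MvPolynomial (Fin 3) ℝ) :
    ∃ c : Fin 6 → MvPolynomial (Fin 3) ℝ, (∀ j, c j ∈ Algebra.adjoin ℝ (Set.range s3PowerSumVec)) ∧ q = ∑ j : Fin 6, c j * s3HarmonicPoly j := by
  induction q using MvPolynomial.induction_on with
  | C a =>
      refine ⟨fun j => if j = 0 then C a else 0, fun j => ?_, ?_⟩
      · by_cases hj : j = 0
        · simp only [hj, if_true]; exact Subalgebra.algebraMap_mem _ a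
        · simp only [hj, if_false]; exact zero_mem _
      · simp [s3HarmonicPoly]
  | add p q hp hq =>
      obtain ⟨c, hc, hp⟩ := hp
      obtain ⟨d, hd, hq⟩ := hq
      refine ⟨fun j => c j + d j, fun j => add_mem (hc j) (hd j), ?_⟩
      rw [hp, hq, ← Finset.sum_add_distrib]
      refine Finset.sum_congr rfl fun j _ => ?_
      ring
  | mul_X p k hp =>
      obtain ⟨c, hc, hp⟩ := hp
      refine ⟨fun l => ∑ j : Fin 6, c j * ((1 / 18 : ℝ) • aeval s3PowerSumVec (s3CoeffPoly k j l)), fun l => ?_, ?_⟩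
      · exact Subalgebra.sum_mem _ fun j _ => Subalgebra.mul_mem _ (hc j) (Subalgebra.smul_mem _ (aeval_s3CoeffPoly_mem_adjoin k j l) _)
      · rw [hp, Finset.sum_mul]
        have hx : ∀ j : Fin 6, c j * s3HarmonicPoly j * X k = c j * (X k * s3HarmonicPoly j) := fun j => by ring
        simp only [hx, X_mul_s3HarmonicPoly, Finset.mul_sum, Finset.sum_mul]
        rw [Finset.sum_comm]
        refine Finset.sum_congr rfl fun l _ => Finset.sum_congr rfl fun j _ => ?_
        ring

end Literature.Algebra.Polynomial

end
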